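import Literature.IUT.HodgeTheaters.GaloisValDatumCoveringMonoidComparison
import Literature.IUT.HodgeArakelov.GMonoidFrobenioidsEquivalence
import Literature.AlgebraicGeometry.Frobenioids.PadicFrobenioidUnitGroups
import Literature.AlgebraicGeometry.Frobenioids.ModelFrobenioidPreFrobenioid
import HarnessLib

/-!
# B16 closer, part 2: the [IUTchII] Def. 3.8 model Frobenioid of the GENUINE `C⊢_v` covering monoid `𝒪^×_{K̄_v}·q̲^ℕ ↶ G_v`
# IS (equivalent to) the GENUINE `C⊢_v` of [IUTchI] Ex. 3.2 (iv) — the comparison functor over the identity of `B(K_v)⁰`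

Mochizuki, *Inter-universal Teichmüller Theory I*, kurims manuscript (May 2020), Ex. 3.2 (iv) p. 71: «`Φ_{C⊢_v} :=
ℕ·log_Φ(q̲_v)|_{D⊢_v}` … determines a `p_v`-adic Frobenioid with base category given by `D⊢_v`» [cite: Mochizuki2012, I Ex 3.2
(iv) p.71]; *… II*, Def. 3.8 (i) p. 113 «`F_{†C_v}` … equipped with natural isomorphisms … `F_{†C_v} ⥲ †C_v` [a
tautological isomorphism of Frobenioids]» [cite: Mochizuki2012, II Def 3.8 (i) p.113] (D-0012 claim key, status disputed;
nothing of the series is asserted); [FrdII] Ex. 1.1 (ii) p. 8 («`B := B₀|_D ×_{Φ₀^gp|_D} Φ^gp → Φ^gp`») [cite: MochizukiFrdII2008,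
Ex 1.1 (ii) p.8]; [FrdI] Thm. 5.2 (i) p. 100, Prop. 5.3 p. 103, Cor. 5.4 p. 104 («the horizontal arrows are equivalences»)
[cite: MochizukiFrdI2008, Cor. 5.4 p.104].

Cell abc-iut, MERGE-MAP register row **B16** (plan/L6/MERGE-MAP.md §8S), item «(δ2-β) PART 2», written by seat abc-iut-L6-t7
gen 5 (the register's writer) on abc-iut-L5-lead's standing offer (STATUS 20:55:11Z; spec of record = abc-iut-L5-t2 gen-7
HANDOFF «NEXT»).  DEF-BEARING, minimal: data declarations `BAmb` (the concrete ambient group type of `B^c`), `betaAmb` (`β`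
retyped into it), `betaNatTrans` (a natural transformation), `comparisonDataHom` (abc-iut-L1's `ModelFrobenioid.DataHom`),
`comparison` / `badComparison` (the functor); everything else is a theorem; 0 instances / notation / `Prop` facts; nothing
landed is edited.  Consumed BY NAME: abc-iut-L5-t2's `dashCoveringMonoid` (p456702), `divisorObjEquiv(_pull)` /
`divisorFunctorIso` / `toΩInvariant` / `invariantUnitOfIsUnit` / `invDashOrdHom_*` (p463243), `betaApp(_of)` / `pairHom` /
`bZeroHom(_pull)` / `gpPowHom_apply` / `val_val_toFixedDashInt` / `valuation_fixedFld_eq_one_iff` (p465375), `dashDatum` /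
`Cdash` / `relEmb` / `fieldFunctor(_isPadicLocal)`; abc-iut-w4-d019's `CoveringMonoid.ratFnFunctor / divB / frobenioid / pull`
(p455796); abc-iut-L1's `DataHom.functor` / `gpApp_of` / `MonGp.map_of` / `MonGp.hom_ext` / `gp_exists_mul_of_eq_of` /
`Monogenic.BSub` / `BMap` / `ΦMap` / `gen` / `divZeroHom_intNonzeroToUnits` / `ker_divZeroHom_eq_unitSubgroup`; abc-iut-L6-t7's
[FrdI] Cor. 5.4-at-`𝟭` criterion `dataHom_functor_isEquivalence_of_bijective` (p466730).

WHAT THIS FILE CONSTRUCTS / PROVES (`M := d.dashCoveringMonoid q`, `hq : ¬ IsUnit q`, base `B(K_v)⁰ = CosetCat G_v`):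
* `betaNatTrans hq : M.ratFnFunctor ⟶ (d.dashDatum hq).B` — abc-iut-L5-t2's `betaApp` IS natural (`(M^V)^gp → B^c(G/V)`
  intertwines (A)'s pull-backs with L1-t4's restriction maps of the fibre product; checked on generators in the concrete
  group `(Ω^V)^× × (ℕ·log_Φ(q̲))^gp`: `bZeroHom_pull` on the `B₀`-coordinate, `divisorObjEquiv_pull` on the divisor coordinate);
* `comparisonDataHom hq : ModelFrobenioid.DataHom M.divB (d.dashDatum hq).divB` with `η := (divisorFunctorIso hq).hom` — the
  square `Div_B ∘ β = η^gp ∘ Div_B` (both send `[u·q̲^n]` to `[log_Φ(q̲)^n]`);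
* **`comparison hq : M.frobenioid ⥤ d.Cdash hq`** — abc-iut-L1's `DataHom.functor`, over the identity of `B(K_v)⁰` ON THE NOSE
  (`comparison_comp_baseFunctor`, `rfl`): the «tautological isomorphism of Frobenioids `F_{†C⊢_v} ⥲ †C⊢_v`» of Def. 3.8 (i)
  at the GENUINE `C⊢_v`;
* `betaApp_injective` (an element of `𝒪^×·q̲^ℕ` is determined by its value in `Ω`), **`betaApp_surjective`** (for
  `(u, [log^a]/[log^b]) ∈ B^c(G/V)`: `Div₀(u·c^b·c^{-a}) = 1`, so `u·c^b = w·c^a` with `w ∈ 𝒪^×_{Ω^V}` by abc-iut-L1's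
  `ker_divZeroHom_eq_unitSubgroup` at the `p`-adic local fixed field `Ω^V`; preimage `[w·q̲^a]/[q̲^b]`);
* **`comparison_isEquivalence`** — the comparison functor is an EQUIVALENCE of categories ([FrdI] Cor. 5.4 at `𝟭`, p466730);
  `nonempty_frobenioid_equivalence_Cdash`;
* AT THE GENUINE DATUM (`InitialThetaData D`, `v̲ = w ∣ v ∈ V(F)^bad`): **`InitialThetaData.badComparison`** and
  **`badComparison_isEquivalence`** — abc-iut-w4-d019's [IUTchII] Def. 3.8 model Frobenioid of `D.badCoveringMonoidAt`
  (`𝒪^×_{K̄_w}·q̲_v̲^ℕ ↶ Gal(K̄_w/K_w)`) is EQUIVALENT, over `𝟭 B(K_v̲)⁰`, to the GENUINE `C⊢_v̲ = D.badCdashAt` of [IUTchI] Ex. 3.2 (iv).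
HONEST FRAMING: monoid/valuation bookkeeping over the tree's interfaces; closes MERGE-MAP B16 at the Frobenioid level (the
K-L6 bad-place Frobenioid DATA binder meets a genuine object); NOT a Kummer structure, NOT the disputed comparison; no side
taken on [IUTchIII] Cor. 3.12; [IUTchI]/[IUTchII] disputed, nothing asserted; typed ≠ proved for anything else.
-/

noncomputable section

open scoped Classical

namespace Literature.IUT.HodgeTheaters

open CategoryTheory Opposite Function Literature.AnabelianGeometry.SemiGraphs Literature.AlgebraicGeometry.Frobenioids
  Literature.AlgebraicGeometry.Frobenioids.PadicFrd Literature.IUT.HodgeArakelov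

universe u

namespace GaloisValDatum

variable {p : ℕ} [Fact p.Prime] (d : GaloisValDatum.{u} p) {q : intNonzero d.k} (hq : ¬ IsUnit q)

/-! ### 1. The concrete ambient GROUP of `B^c(G/V)` and the values of `β` there -/

/-- The concrete ambient GROUP `(Ω^V)^× × (ℕ·log_Φ(q̲)(G/V))^gp` of abc-iut-L1-t4's fibre product `B^c(G/V)` (homomorphisms out
of a groupification are compared here, where `MonGp.hom_ext` applies). [cite: MochizukiFrdII2008, Ex 1.1 (ii) p.8] -/
abbrev BAmb (q : intNonzero d.k) (X : CosetCat d.Gal) : Type u :=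
  ((d.fieldFunctor.obj X).K)ˣ × Algebra.GrothendieckGroup ↥(Submonoid.powers (Monogenic.gen d.fieldFunctor (d.relEmb.img q) X))

/-- `β(G/V)` read in the concrete group: `(M^V)^gp →* (Ω^V)^× × (ℕ·log_Φ(q̲))^gp` (abc-iut-L5-t2's `betaApp`, retyped). [cite: MochizukiFrdII2008, Ex 1.1 (ii) p.8] -/
def betaAmb (X : CosetCat d.Gal) :
    Algebra.GrothendieckGroup ↥((d.dashCoveringMonoid q).invariants (X.sg : Subgroup d.Gal)) →* d.BAmb q X where
  toFun z := ((Subtype.val (d.betaApp hq X z)).1, (Subtype.val (d.betaApp hq X z)).2)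
  map_one' := by
    refine Prod.ext ?_ ?_
    · exact congrArg Prod.fst (congrArg Subtype.val (map_one (d.betaApp hq X)))
    · exact congrArg Prod.snd (congrArg Subtype.val (map_one (d.betaApp hq X)))
  map_mul' z z' := by
    refine Prod.ext ?_ ?_
    · exact congrArg Prod.fst (congrArg Subtype.val (map_mul (d.betaApp hq X) z z'))
    · exact congrArg Prod.snd (congrArg Subtype.val (map_mul (d.betaApp hq X) z z'))

/-- `betaApp` is recovered from `β` in the concrete group. [cite: MochizukiFrdII2008, Ex 1.1 (ii) p.8] -/
theorem betaApp_eq_iff_betaAmb_eq (X : CosetCat d.Gal)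
    (z : Algebra.GrothendieckGroup ↥((d.dashCoveringMonoid q).invariants (X.sg : Subgroup d.Gal)))
    (b : ↥(Monogenic.BSub d.fieldFunctor (d.relEmb.isConstantSection hq) (op X))) :
    d.betaApp hq X z = b ↔ d.betaAmb hq X z = ((Subtype.val b).1, (Subtype.val b).2) := by
  constructor
  · rintro rfl
    rfl
  · intro h
    exact Subtype.ext (Prod.ext (congrArg Prod.fst h) (congrArg Prod.snd h))

/-- `β` in the concrete group on a generator `[x]`: `pairHom x = (u·q̲^n, [log_Φ(q̲)^n])`. [cite: MochizukiFrdII2008, Ex 1.1 (ii) p.8] -/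
theorem betaAmb_of (X : CosetCat d.Gal) (x : (d.dashCoveringMonoid q).invariants (X.sg : Subgroup d.Gal)) :
    d.betaAmb hq X (Algebra.GrothendieckGroup.of x) = d.pairHom hq X x :=
  Prod.ext (congrArg Prod.fst (d.betaApp_of hq X x)) (congrArg Prod.snd (d.betaApp_of hq X x))

/-- `β(G/V)` on a generator `[x]`, as an element of `B^c(G/V)`: `⟨pairHom x, _⟩`. [cite: MochizukiFrdII2008, Ex 1.1 (ii) p.8] -/
theorem betaApp_of_eq (X : CosetCat d.Gal) (x : (d.dashCoveringMonoid q).invariants (X.sg : Subgroup d.Gal)) :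
    d.betaApp hq X (Algebra.GrothendieckGroup.of x) = ⟨d.pairHom hq X x, d.pairHom_mem_BSub hq X x⟩ :=
  Subtype.ext (d.betaApp_of hq X x)

/-! ### 2. `β` is natural: `M.ratFnFunctor ⟶ (d.dashDatum hq).B` -/

/-- Naturality of `β` on a generator, in the concrete group: along `f : G/U → G/V`, (A)'s pull-back then `β(G/U)` agrees with
`β(G/V)` then L1-t4's restriction map of `B^c` (`bZeroHom_pull`; `divisorObjEquiv_pull`). [cite: Mochizuki2012, II Def 3.8 (i) p.113] -/
theorem betaAmb_pull_of {X Y : CosetCat d.Gal} (f : X ⟶ Y) (y : (d.dashCoveringMonoid q).invariants (Y.sg : Subgroup d.Gal)) :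
    d.betaAmb hq X (MonGp.map ((d.dashCoveringMonoid q).pull f) (Algebra.GrothendieckGroup.of y)) =
      (Units.map ((d.fieldFunctor.map f).alg : (d.fieldFunctor.obj Y).K →* (d.fieldFunctor.obj X).K) (d.bZeroHom Y y),
        MonGp.map (Monogenic.ΦMap d.fieldFunctor (d.relEmb.isConstantSection hq) f.op) (d.gpPowHom hq Y y)) := by
  refine ((congrArg (d.betaAmb hq X) (MonGp.map_of _ y)).trans (d.betaAmb_of hq X _)).trans (Prod.ext (d.bZeroHom_pull f y) ?_)
  exact (congrArg Algebra.GrothendieckGroup.of (d.divisorObjEquiv_pull hq f (Associates.mk y))).trans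
    (MonGp.map_of _ _).symm

/-- **Naturality of `β` on the monoid maps**: along `f : G/U → G/V`, (A)'s pull-back `(M^V)^gp → (M^U)^gp` followed by `β(G/U)`
equals `β(G/V)` followed by abc-iut-L1-t4's restriction map `B^c(G/V) → B^c(G/U)`. [cite: Mochizuki2012, II Def 3.8 (i) p.113] -/
theorem betaApp_natural {X Y : CosetCat d.Gal} (f : X ⟶ Y) :
    (d.betaApp hq X).comp (MonGp.map ((d.dashCoveringMonoid q).pull f)) =
      (Monogenic.BMap d.fieldFunctor (d.relEmb.isConstantSection hq) f.op).comp (d.betaApp hq Y) := by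
  -- the right-hand side read in the concrete group: `(B₀(f) × (Φ^c)^gp(f)) ∘ β(G/V)`
  have key : (d.betaAmb hq X).comp (MonGp.map ((d.dashCoveringMonoid q).pull f)) =
      (MonoidHom.prodMap (Units.map ((d.fieldFunctor.map f).alg : (d.fieldFunctor.obj Y).K →* (d.fieldFunctor.obj X).K))
          (MonGp.map (Monogenic.ΦMap d.fieldFunctor (d.relEmb.isConstantSection hq) f.op))).comp (d.betaAmb hq Y) :=
    MonGp.hom_ext fun y =>
      (d.betaAmb_pull_of hq f y).trans
        (show (MonoidHom.prodMap (Units.map ((d.fieldFunctor.map f).alg : (d.fieldFunctor.obj Y).K →* (d.fieldFunctor.obj X).K))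
            (MonGp.map (Monogenic.ΦMap d.fieldFunctor (d.relEmb.isConstantSection hq) f.op))) (d.pairHom hq Y y) =
          (MonoidHom.prodMap (Units.map ((d.fieldFunctor.map f).alg : (d.fieldFunctor.obj Y).K →* (d.fieldFunctor.obj X).K))
            (MonGp.map (Monogenic.ΦMap d.fieldFunctor (d.relEmb.isConstantSection hq) f.op))) (d.betaAmb hq Y (Algebra.GrothendieckGroup.of y))
          from congrArg _ (d.betaAmb_of hq Y y).symm)
  refine MonoidHom.ext fun z => (d.betaApp_eq_iff_betaAmb_eq hq X _ _).mpr ?_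
  exact (DFunLike.congr_fun key z).trans rfl

/-- **`β : M.ratFnFunctor ⟶ (d.dashDatum hq).B`** — abc-iut-L5-t2's `betaApp` as a morphism of monoids on `B(K_v)⁰` from (A)'s
rational-function monoid `G/V ↦ (M^V)^gp` to abc-iut-L1-t4's fibre product `G/V ↦ B^c(G/V)` of the GENUINE `C⊢_v` (NATURALITY =
`betaApp_natural`). [cite: Mochizuki2012, II Def 3.8 (i) p.113] -/
def betaNatTrans : (d.dashCoveringMonoid q).ratFnFunctor ⟶ (d.dashDatum hq).B where
  app X := CommMonCat.ofHom (d.betaApp hq (unop X))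
  naturality X Y f := by
    apply CommMonCat.hom_ext
    exact d.betaApp_natural hq f.unop

/-! ### 3. The morphism of model data and the comparison functor over `𝟭 B(K_v)⁰` -/

/-- Components of abc-iut-L5-t2's `divisorFunctorIso` are the `divisorObjEquiv`s (bookkeeping). [cite: Mochizuki2012, I Ex 3.2 (iv) p.71] -/
theorem divisorFunctorIso_hom_app_apply (A : (CosetCat d.Gal)ᵒᵖ)
    (y : Associates ↥((d.dashCoveringMonoid q).invariants ((unop A).sg : Subgroup d.Gal))) :
    ((d.divisorFunctorIso hq).hom.app A).hom y = d.divisorObjEquiv hq (unop A) y := rfl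

/-- The square `Div_B ∘ β = η^gp ∘ Div` of the comparison on a generator `[x]`, `x = u·q̲^n`: both sides are `[log_Φ(q̲)^n]`.
[cite: MochizukiFrdI2008, Prop. 5.3 p.103] -/
theorem divB_comparison_comm_of (A : (CosetCat d.Gal)ᵒᵖ) (x : (d.dashCoveringMonoid q).invariants ((unop A).sg : Subgroup d.Gal)) :
    gpApp (d.divisorFunctorIso hq).hom A
        (AlgebraicGeometry.Frobenioids.divB _ _ (d.dashCoveringMonoid q).divB A (Algebra.GrothendieckGroup.of x)) =
      AlgebraicGeometry.Frobenioids.divB _ _ (d.dashDatum hq).divB A (d.betaApp hq (unop A) (Algebra.GrothendieckGroup.of x)) := by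
  rw [betaApp_of_eq]
  change gpApp (d.divisorFunctorIso hq).hom A
      (MonGp.map (Associates.mkMonoidHom : (d.dashCoveringMonoid q).invariants ((unop A).sg : Subgroup d.Gal) →* _)
        (Algebra.GrothendieckGroup.of x)) = d.gpPowHom hq (unop A) x
  rw [MonGp.map_of, gpPowHom_apply]
  exact (gpApp_of (d.divisorFunctorIso hq).hom A (Associates.mk x)).trans
    (congrArg Algebra.GrothendieckGroup.of (d.divisorFunctorIso_hom_app_apply hq A (Associates.mk x)))

/-- **The morphism of model data `(Φ_M, B_M, Div) → (Φ_{C⊢_v}, B^c, Div_B)`** on the ONE base `B(K_v)⁰`: `η` = abc-iut-L5-t2's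
`divisorFunctorIso` (p463243), `β` = `betaNatTrans`, square `divB_comparison_comm_of`. [cite: MochizukiFrdI2008, Prop. 5.3 p.103] -/
def comparisonDataHom : ModelFrobenioid.DataHom (d.dashCoveringMonoid q).divB (d.dashDatum hq).divB where
  η := (d.divisorFunctorIso hq).hom
  β := d.betaNatTrans hq
  comm A u := by
    have key : (gpApp (d.divisorFunctorIso hq).hom A).comp
          (AlgebraicGeometry.Frobenioids.divB _ _ (d.dashCoveringMonoid q).divB A) =
        (AlgebraicGeometry.Frobenioids.divB _ _ (d.dashDatum hq).divB A).comp (d.betaApp hq (unop A)) :=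
      MonGp.hom_ext fun x => d.divB_comparison_comm_of hq A x
    exact DFunLike.congr_fun key u

/-- **The comparison functor `F(G_v ↷ 𝒪^×_{K̄_v}·q̲^ℕ) ⥤ C⊢_v`** from abc-iut-w4-d019's [IUTchII] Def. 3.8 model Frobenioid of the
GENUINE `C⊢_v` covering monoid to the GENUINE `C⊢_v` of [IUTchI] Ex. 3.2 (iv) (abc-iut-L1's `DataHom.functor`) — the «tautological
isomorphism of Frobenioids `F_{†C⊢_v} ⥲ †C⊢_v`» of Def. 3.8 (i) at the genuine `C⊢_v`. [cite: Mochizuki2012, II Def 3.8 (i) p.113] -/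
def comparison : (d.dashCoveringMonoid q).frobenioid ⥤ d.Cdash hq := (d.comparisonDataHom hq).functor

/-- The comparison functor lies over the IDENTITY of `B(K_v)⁰` on the nose. [cite: Mochizuki2012, I Ex 3.2 (iv) p.71] -/
theorem comparison_comp_baseFunctor : d.comparison hq ⋙ d.CdashBase hq =
    ModelFrobenioid.baseFunctor (d.dashCoveringMonoid q).divisorFunctor (d.dashCoveringMonoid q).ratFnFunctor
      (d.dashCoveringMonoid q).divB := rfl

/-! ### 4. `β(G/V)` is bijective -/

/-- An element of `M^V ⊆ 𝒪^×_{K̄_v}·q̲^ℕ` is determined by its value in `Ω^V ⊆ Ω`. [cite: MochizukiFrdII2008, Ex 1.1 (ii) p.8] -/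
theorem eq_of_bZeroHom_eq (X : CosetCat d.Gal) {x y : (d.dashCoveringMonoid q).invariants (X.sg : Subgroup d.Gal)}
    (h : d.bZeroHom X x = d.bZeroHom X y) : x = y := by
  have h1 : Subtype.val (Subtype.val (d.toFixedDashInt X x)) = Subtype.val (Subtype.val (d.toFixedDashInt X y)) :=
    congrArg (fun t : ((d.fieldFunctor.obj X).K)ˣ => Subtype.val (t : (d.fieldFunctor.obj X).K)) h
  rw [val_val_toFixedDashInt, val_val_toFixedDashInt] at h1
  exact Subtype.ext (Subtype.ext (Subtype.ext h1))

/-- **`β(G/V)` is injective** (every `z ∈ (M^V)^gp` is `[a]/[b]`; `β z = 1` forces `pairHom a = pairHom b`, so `a = b`). [cite: MochizukiFrdI2008, Cor. 5.4 p.104] -/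
theorem betaApp_injective (X : CosetCat d.Gal) : Injective (d.betaApp hq X) := by
  have hinj : Injective (d.betaAmb hq X) := by
    refine (injective_iff_map_eq_one _).mpr fun z hz => ?_
    obtain ⟨a, b, hab⟩ := gp_exists_mul_of_eq_of z
    have h1 : d.betaAmb hq X z * d.betaAmb hq X (Algebra.GrothendieckGroup.of b) =
        d.betaAmb hq X (Algebra.GrothendieckGroup.of a) :=
      (map_mul (d.betaAmb hq X) z _).symm.trans (congrArg (d.betaAmb hq X) hab)
    have h2 : d.pairHom hq X b = d.pairHom hq X a :=
      calc d.pairHom hq X b = d.betaAmb hq X (Algebra.GrothendieckGroup.of b) := (d.betaAmb_of hq X b).symm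
        _ = d.betaAmb hq X z * d.betaAmb hq X (Algebra.GrothendieckGroup.of b) :=
            ((one_mul _).symm.trans (congrArg (· * d.betaAmb hq X (Algebra.GrothendieckGroup.of b)) hz.symm))
        _ = d.betaAmb hq X (Algebra.GrothendieckGroup.of a) := h1
        _ = d.pairHom hq X a := d.betaAmb_of hq X a
    have hab' : b = a := d.eq_of_bZeroHom_eq X (congrArg Prod.fst h2)
    rw [hab'] at hab
    exact mul_eq_right.mp hab
  intro z z' h
  exact hinj ((d.betaApp_eq_iff_betaAmb_eq hq X z (d.betaApp hq X z')).mp h)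

/-- `bZeroHom` of the `V`-invariant element `q̲` is `c_V := q̲` read in `(Ω^V)^×` (abc-iut-L5-t2's `relEmb.img q X`).
[cite: Mochizuki2012, I Ex 3.2 (iv) p.71] -/
theorem bZeroHom_toΩInvariant (X : CosetCat d.Gal) :
    d.bZeroHom X (d.toΩInvariant q (X.sg : Subgroup d.Gal)) = intNonzeroToUnits (d.fieldFunctor.obj X).K (d.relEmb.img q X) :=
  Units.ext (Subtype.ext rfl)

/-- `bZeroHom` of a `V`-invariant unit `w` is `w` read in `(Ω^V)^×`. [cite: MochizukiFrdII2008, Ex 1.1 (ii) p.8] -/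
theorem coe_coe_bZeroHom_invariantUnit (X : CosetCat d.Gal) (w : intNonzero d.Ω) (hw : IsUnit w)
    (hV : ∀ σ ∈ (X.sg : Subgroup d.Gal), d.galAct σ w = w) :
    Subtype.val ((d.bZeroHom X ((d.invariantUnitOfIsUnit (q := q) (X.sg : Subgroup d.Gal) w hw hV :
        (↥((d.dashCoveringMonoid q).invariants (X.sg : Subgroup d.Gal)))ˣ) :
          (d.dashCoveringMonoid q).invariants (X.sg : Subgroup d.Gal)) : ((d.fieldFunctor.obj X).K)ˣ) :
        (d.fieldFunctor.obj X).K) = (w : d.Ω) := rfl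

/-- The divisor of `w·q̲^a` (`w` a `V`-invariant unit) is `a`. [cite: Mochizuki2012, I Ex 3.2 (iv) p.71] -/
theorem dashOrd_unit_mul_pow (X : CosetCat d.Gal) (w : (↥((d.dashCoveringMonoid q).invariants (X.sg : Subgroup d.Gal)))ˣ) (a : ℕ) :
    d.dashOrd hq (d.ofO ((w : (d.dashCoveringMonoid q).invariants (X.sg : Subgroup d.Gal)) *
        d.toΩInvariant q (X.sg : Subgroup d.Gal) ^ a).1) = a := by
  apply Multiplicative.ofAdd.injective
  rw [← invDashOrdHom_apply, map_mul, map_pow, invDashOrdHom_units, invDashOrdHom_toΩInvariant, one_mul, ← ofAdd_nsmul,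
    smul_eq_mul, mul_one]

/-- The divisor coordinate of `pairHom` of an element of divisor `a` is `[log_Φ(q̲)^a]`. [cite: MochizukiFrdII2008, Ex 1.1 (ii) p.8] -/
theorem gpPowHom_eq_of_dashOrd_eq (X : CosetCat d.Gal) (x : (d.dashCoveringMonoid q).invariants (X.sg : Subgroup d.Gal)) {a : ℕ}
    (ha : d.dashOrd hq (d.ofO x.1) = a) (s : Submonoid.powers (Monogenic.gen d.fieldFunctor (d.relEmb.img q) X))
    (hs : Monogenic.gen d.fieldFunctor (d.relEmb.img q) X ^ a = s.1) :
    d.gpPowHom hq X x = Algebra.GrothendieckGroup.of s := by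
  rw [gpPowHom_apply]
  congr 1
  exact Subtype.ext (by rw [coe_divisorObjEquiv_mk, ha, hs])

/-- **`β(G/V)` is surjective.**  For `(u, γ) ∈ B^c(G/V)`, `γ·[log^b] = [log^a]`: `Div₀(u·c^b·c^{-a}) = 1`, so `u·c^b·c^{-a} ∈ 𝒪^×_{Ω^V}`
(abc-iut-L1's `ker_divZeroHom_eq_unitSubgroup` at the `p`-adic local `Ω^V`); then `[w·q̲^a]/[q̲^b] ↦ (u, γ)`. [cite: MochizukiFrdI2008, Cor. 5.4 p.104] -/
theorem betaApp_surjective (X : CosetCat d.Gal) : Surjective (d.betaApp hq X) := by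
  intro bb
  obtain ⟨⟨u, γ⟩, hb⟩ := bb
  -- read the coordinates in the concrete types `(Ω^V)^×`, `(ℕ·log_Φ(q̲))^gp`
  change ((d.fieldFunctor.obj X).K)ˣ at u
  change Algebra.GrothendieckGroup ↥(Submonoid.powers (Monogenic.gen d.fieldFunctor (d.relEmb.img q) X)) at γ
  -- `γ · [t] = [s]`, `s = log^a`, `t = log^b`
  obtain ⟨s, t, hst⟩ := gp_exists_mul_of_eq_of γ
  obtain ⟨a, ha⟩ := (Submonoid.mem_powers_iff _ _).mp s.2
  obtain ⟨b, hbt⟩ := (Submonoid.mem_powers_iff _ _).mp t.2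
  -- the `p`-adic local structure of `Ω^V`
  obtain ⟨⟨inst, hfin, hc⟩⟩ := d.fieldFunctor_isPadicLocal X
  letI := inst
  haveI := hfin
  -- `c = q̲` read in `(Ω^V)^×`, with `Div₀(c) = [log_Φ(q̲)]`
  set c : ((d.fieldFunctor.obj X).K)ˣ := intNonzeroToUnits (d.fieldFunctor.obj X).K (d.relEmb.img q X) with hcdef
  have hcdiv : divZeroHom (d.fieldFunctor.obj X).K c =
      Algebra.GrothendieckGroup.of (Monogenic.gen d.fieldFunctor (d.relEmb.img q) X) :=
    divZeroHom_intNonzeroToUnits _ _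
  -- the fibre-product condition, unpacked: `Div₀(u) = [log]^a · ([log]^b)⁻¹`
  have hmem : divZeroHom (d.fieldFunctor.obj X).K u =
      MonGp.map (Submonoid.powers (Monogenic.gen d.fieldFunctor (d.relEmb.img q) X)).subtype γ := hb
  have hγ : MonGp.map (Submonoid.powers (Monogenic.gen d.fieldFunctor (d.relEmb.img q) X)).subtype γ =
      Algebra.GrothendieckGroup.of (Monogenic.gen d.fieldFunctor (d.relEmb.img q) X) ^ a *
        (Algebra.GrothendieckGroup.of (Monogenic.gen d.fieldFunctor (d.relEmb.img q) X) ^ b)⁻¹ := by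
    rw [eq_mul_inv_of_mul_eq hst]
    simp only [map_mul, map_inv, MonGp.map_of, Submonoid.subtype_apply, ← ha, ← hbt, map_pow]
  -- `w₀ := u·c^b·c^{-a}` has trivial divisor, hence is a unit of `𝒪_{Ω^V}`
  have hdiv : divZeroHom (d.fieldFunctor.obj X).K (u * c ^ b * (c ^ a)⁻¹) = 1 :=
    calc divZeroHom (d.fieldFunctor.obj X).K (u * c ^ b * (c ^ a)⁻¹)
        = divZeroHom (d.fieldFunctor.obj X).K u * divZeroHom (d.fieldFunctor.obj X).K c ^ b *
            (divZeroHom (d.fieldFunctor.obj X).K c ^ a)⁻¹ := by simp only [map_mul, map_inv, map_pow]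
      _ = Algebra.GrothendieckGroup.of (Monogenic.gen d.fieldFunctor (d.relEmb.img q) X) ^ a *
            (Algebra.GrothendieckGroup.of (Monogenic.gen d.fieldFunctor (d.relEmb.img q) X) ^ b)⁻¹ *
            Algebra.GrothendieckGroup.of (Monogenic.gen d.fieldFunctor (d.relEmb.img q) X) ^ b *
            (Algebra.GrothendieckGroup.of (Monogenic.gen d.fieldFunctor (d.relEmb.img q) X) ^ a)⁻¹ :=
          congrArg₂ (fun x y => x * y ^ b * (y ^ a)⁻¹) (hmem.trans hγ) hcdiv
      _ = 1 := by simp only [inv_mul_cancel_right, mul_inv_cancel]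
  have hw₀ : u * c ^ b * (c ^ a)⁻¹ ∈ unitSubgroup (d.fieldFunctor.obj X).K := by
    rw [← ker_divZeroHom_eq_unitSubgroup hc, MonoidHom.mem_ker]
    exact hdiv
  -- … so its value in `Ω` is a `V`-invariant unit of `𝒪^▷_{K̄_v}`
  have hv1 : ValuativeRel.valuation (d.fieldFunctor.obj X).K ((u * c ^ b * (c ^ a)⁻¹ : ((d.fieldFunctor.obj X).K)ˣ) :
      (d.fieldFunctor.obj X).K) = 1 :=
    (mem_unitSubgroup_iff ((d.fieldFunctor.obj X).K)).mp hw₀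
  have hval : ValuativeRel.valuation d.Ω
      (Subtype.val ((u * c ^ b * (c ^ a)⁻¹ : ((d.fieldFunctor.obj X).K)ˣ) : (d.fieldFunctor.obj X).K)) = 1 :=
    (d.valuation_fixedFld_eq_one_iff X _).mp hv1
  have hwmem : Subtype.val ((u * c ^ b * (c ^ a)⁻¹ : ((d.fieldFunctor.obj X).K)ˣ) : (d.fieldFunctor.obj X).K) ∈
      intNonzero d.Ω := by
    refine ⟨le_of_eq hval, fun h0 => ?_⟩
    rw [h0, map_zero] at hval
    exact zero_ne_one hval
  have hwU : IsUnit (⟨_, hwmem⟩ : intNonzero d.Ω) := (isUnit_intNonzero_iff d.Ω _).mpr hval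
  have hV : ∀ σ ∈ (X.sg : Subgroup d.Gal), d.galAct σ ⟨_, hwmem⟩ = ⟨_, hwmem⟩ := fun σ hσ =>
    Subtype.ext ((IntermediateField.mem_fixedField_iff _ _).mp
      ((u * c ^ b * (c ^ a)⁻¹ : ((d.fieldFunctor.obj X).K)ˣ) : (d.fieldFunctor.obj X).K).2 σ hσ)
  -- the preimage `[w·q̲^a]/[q̲^b]`
  let wM := d.invariantUnitOfIsUnit (q := q) (X.sg : Subgroup d.Gal) ⟨_, hwmem⟩ hwU hV
  let x₁ : (d.dashCoveringMonoid q).invariants (X.sg : Subgroup d.Gal) :=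
    (wM : (d.dashCoveringMonoid q).invariants (X.sg : Subgroup d.Gal)) * d.toΩInvariant q (X.sg : Subgroup d.Gal) ^ a
  let x₂ : (d.dashCoveringMonoid q).invariants (X.sg : Subgroup d.Gal) := d.toΩInvariant q (X.sg : Subgroup d.Gal) ^ b
  refine ⟨Algebra.GrothendieckGroup.of x₁ * (Algebra.GrothendieckGroup.of x₂)⁻¹, ?_⟩
  -- check in the concrete group
  rw [betaApp_eq_iff_betaAmb_eq]
  simp only [map_mul, map_inv, betaAmb_of]
  change d.pairHom hq X x₁ * (d.pairHom hq X x₂)⁻¹ = (u, γ)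
  -- `B₀`-coordinates: `bZeroHom x₁ = w₀·c^a`, `bZeroHom x₂ = c^b`
  have hwM : d.bZeroHom X (wM : (d.dashCoveringMonoid q).invariants (X.sg : Subgroup d.Gal)) = u * c ^ b * (c ^ a)⁻¹ :=
    Units.ext (Subtype.ext (d.coe_coe_bZeroHom_invariantUnit X _ hwU hV))
  have h1 : (d.pairHom hq X x₁).1 = u * c ^ b * (c ^ a)⁻¹ * c ^ a := by
    change d.bZeroHom X ((wM : (d.dashCoveringMonoid q).invariants (X.sg : Subgroup d.Gal)) *
      d.toΩInvariant q (X.sg : Subgroup d.Gal) ^ a) = _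
    simp only [map_mul, map_pow, hwM, bZeroHom_toΩInvariant, hcdef]
  have h2 : (d.pairHom hq X x₂).1 = c ^ b := by
    change d.bZeroHom X (d.toΩInvariant q (X.sg : Subgroup d.Gal) ^ b) = _
    simp only [map_pow, bZeroHom_toΩInvariant, hcdef]
  -- divisor coordinates: `[log^a]`, `[log^b]`
  have h3 : (d.pairHom hq X x₁).2 = Algebra.GrothendieckGroup.of s := by
    change d.gpPowHom hq X x₁ = _
    exact d.gpPowHom_eq_of_dashOrd_eq hq X x₁ (d.dashOrd_unit_mul_pow hq X wM a) s ha
  have h4 : (d.pairHom hq X x₂).2 = Algebra.GrothendieckGroup.of t := by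
    change d.gpPowHom hq X x₂ = _
    refine d.gpPowHom_eq_of_dashOrd_eq hq X x₂ ?_ t hbt
    have h := d.dashOrd_unit_mul_pow hq X 1 b
    rwa [Units.val_one, one_mul] at h
  refine Prod.ext ?_ ?_
  · change (d.pairHom hq X x₁).1 * ((d.pairHom hq X x₂).1)⁻¹ = u
    simp only [h1, h2, inv_mul_cancel_right, mul_inv_cancel_right]
  · change (d.pairHom hq X x₁).2 * ((d.pairHom hq X x₂).2)⁻¹ = γ
    simp only [h3, h4]
    exact (eq_mul_inv_of_mul_eq hst).symm

/-- **`β(G/V)` is bijective: `(M^V)^gp ≅ B^c(G/V)`** at every object. [cite: MochizukiFrdI2008, Cor. 5.4 p.104] -/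
theorem betaApp_bijective (X : CosetCat d.Gal) : Bijective (d.betaApp hq X) :=
  ⟨d.betaApp_injective hq X, d.betaApp_surjective hq X⟩

/-! ### 5. The comparison functor is an equivalence -/

/-- **The comparison functor `F(G_v ↷ 𝒪^×_{K̄_v}·q̲^ℕ) ⥤ C⊢_v` is an EQUIVALENCE of categories** ([FrdI] Cor. 5.4 over the identity of
the base, abc-iut-L6-t7's `dataHom_functor_isEquivalence_of_bijective` p466730): (A)'s [IUTchII] Def. 3.8 model Frobenioid of the GENUINE
`C⊢_v` covering monoid IS the GENUINE `C⊢_v` of [IUTchI] Ex. 3.2 (iv) up to equivalence over `𝟭 B(K_v)⁰`. [cite: Mochizuki2012, II Def 3.8 (i) p.113] -/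
theorem comparison_isEquivalence : (d.comparison hq).IsEquivalence :=
  dataHom_functor_isEquivalence_of_bijective (d.comparisonDataHom hq) (fun X => (d.divisorObjEquiv hq X).bijective)
    fun X => d.betaApp_bijective hq X

/-- `F(G_v ↷ 𝒪^×_{K̄_v}·q̲^ℕ) ≌ C⊢_v`. [cite: Mochizuki2012, II Def 3.8 (i) p.113] -/
theorem nonempty_frobenioid_equivalence_Cdash : Nonempty ((d.dashCoveringMonoid q).frobenioid ≌ d.Cdash hq) :=
  haveI := d.comparison_isEquivalence hq
  ⟨(d.comparison hq).asEquivalence⟩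

end GaloisValDatum

/-! ### 6. At the genuine datum -/

namespace InitialThetaData

open NumberField IsDedekindDomain

variable {F K Fbar : Type} [Field F] [NumberField F] [Field K] [NumberField K] [Algebra F K]
  [Field Fbar] [Algebra F Fbar] [Algebra K Fbar] [IsScalarTower F K Fbar] {E : WeierstrassCurve F}
  [E.IsElliptic] {l : ℕ} {Pb : BadPlacePredicates K} (D : InitialThetaData F K Fbar E l Pb)
  {v : FinitePlace F} (hv : v ∈ D.VFbad) (w : HeightOneSpectrum (𝓞 K)) [w.asIdeal.LiesOver v.maximalIdeal.asIdeal]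
  (p : ℕ) [Fact p.Prime] (hw : ((p : ℕ) : 𝓞 K) ∈ w.asIdeal)

/-- **At the genuine datum**: the comparison functor from (A)'s [IUTchII] Def. 3.8 model Frobenioid of `D.badCoveringMonoidAt hv w p hw`
(`𝒪^×_{K̄_w}·q̲_v̲^ℕ ↶ Gal(K̄_w/K_w)`) to the GENUINE `C⊢_v̲ = D.badCdashAt hv w p hw`, over `𝟭 B(K_v̲)⁰`. [claim: Mochizuki2012, status: disputed] -/
def badComparison : (D.badCoveringMonoidAt hv w p hw).frobenioid ⥤ D.badCdashAt hv w p hw :=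
  (GaloisValDatum.ofPlace K p w hw).comparison (D.qRootAt_not_isUnit hv w p hw)

/-- **It is an equivalence of categories.** [claim: Mochizuki2012, status: disputed] -/
theorem badComparison_isEquivalence : (D.badComparison hv w p hw).IsEquivalence :=
  (GaloisValDatum.ofPlace K p w hw).comparison_isEquivalence (D.qRootAt_not_isUnit hv w p hw)

/-- `F(G_v̲ ↷ 𝒪^×_{K̄_w}·q̲_v̲^ℕ) ≌ C⊢_v̲` at the genuine datum. [claim: Mochizuki2012, status: disputed] -/
theorem nonempty_badCoveringMonoid_frobenioid_equivalence_badCdash :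
    Nonempty ((D.badCoveringMonoidAt hv w p hw).frobenioid ≌ D.badCdashAt hv w p hw) :=
  (GaloisValDatum.ofPlace K p w hw).nonempty_frobenioid_equivalence_Cdash (D.qRootAt_not_isUnit hv w p hw)

end InitialThetaData

end Literature.IUT.HodgeTheaters

end
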